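import Mathlib

/-!
# Venture HSemireg — FORMULA-N THEOREM S (th-6): the rank squeeze ob ↠ / σ ↪

HONEST FRAMING. Part of the Lean index of the computation cell `pub-hsemireg` (seat p3; Sunday enclosure of the
FORMULA-N kernel assets of seats th-7 / th-6, ENCLOSURE-PLAN-p3.md).  Finite-dimensional exterior algebra over a field ONLY:
no variety, no cohomology theory, no semiregularity map is constructed here; nothing here says that HC / HC_CM / HC_AV holds;
no Literature fact is declared or used.  The geometric DICTIONARY (why these ranks are the `HT`-side box ranks of the cell's
STRUCTURE.md §1 / theory/FORMULA-N.md) lives in theory/FORMULA-N-th7.md PART B §A.3 / §N and is NOT asserted in Lean.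

th-6's SQUEEZE (theory/th6/SqueezeStatement.lean sha256/16 d7ea1e01dd7eb4eb), VERBATIM up to the namespace (`HSemiregSqueeze` ↦
`Summit.Ventures.HSemireg.FormulaN.Squeeze`) and the dropped ℕ-arithmetic aside `kerOb_count`: FORMULA-N §3.4 THEOREM S, the
linear-algebra core of FN-1 — for finite-dimensional `HT`, `Ext` over a division ring and linear maps `ob : HT → Ext`, `σ : Ext → H`,
`squeeze : finrank Ext ≤ finrank (range (σ ∘ ob)) ⇒ ob surjective ∧ σ injective ∧ finrank Ext = finrank (range (σ ∘ ob))`, and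
`theoremS` with the BRIDGE `σ ∘ ob = c` as a HYPOTHESIS and a rank bound `R`.  The two geometric inputs FN-1 is modulo (the per-family
Ext bound and the bridge `σ ∘ ob = ⌟ch`, [BuchweitzFlenner2008HH] Thm 6.4.2 on paper) are the named hypotheses; nothing is smuggled.
Theorems only.
-/

open Module LinearMap Submodule

namespace Summit.Ventures.HSemireg.FormulaN.Squeeze

variable {K : Type*} [DivisionRing K]
variable {HT Ext H : Type*} [AddCommGroup HT] [Module K HT] [AddCommGroup Ext] [Module K Ext]
  [AddCommGroup H] [Module K H]
variable [FiniteDimensional K HT] [FiniteDimensional K Ext]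
-- (the target H = ⊕ H^{q+k}(Ω^q) need not be assumed finite-dimensional for the squeeze)

omit [FiniteDimensional K HT] in
/-- rank of a composite is at most the dimension of the middle space. -/
theorem finrank_range_comp_le_mid (ob : HT →ₗ[K] Ext) (σ : Ext →ₗ[K] H) :
    finrank K (range (σ ∘ₗ ob)) ≤ finrank K Ext := by
  calc finrank K (range (σ ∘ₗ ob)) ≤ finrank K (range σ) :=
        Submodule.finrank_mono (LinearMap.range_comp_le_range ob σ)
    _ ≤ finrank K Ext := LinearMap.finrank_range_le σ

omit [FiniteDimensional K Ext] in
/-- rank of a composite is at most the rank of the first map. -/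
theorem finrank_range_comp_le_first (ob : HT →ₗ[K] Ext) (σ : Ext →ₗ[K] H) :
    finrank K (range (σ ∘ₗ ob)) ≤ finrank K (range ob) := by
  rw [LinearMap.range_comp]
  exact Submodule.finrank_map_le σ (range ob)

/-- THE SQUEEZE, abstract form: `dim Ext ≤ rank (σ ∘ ob)` forces `ob` onto, `σ` injective and
`dim Ext = rank (σ ∘ ob)`. -/
theorem squeeze (ob : HT →ₗ[K] Ext) (σ : Ext →ₗ[K] H)
    (h : finrank K Ext ≤ finrank K (range (σ ∘ₗ ob))) :
    Function.Surjective ob ∧ Function.Injective σ ∧ finrank K Ext = finrank K (range (σ ∘ₗ ob)) := by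
  have hmid := finrank_range_comp_le_mid ob σ
  have heq : finrank K Ext = finrank K (range (σ ∘ₗ ob)) := le_antisymm h hmid
  -- ob onto
  have hob_rank : finrank K (range ob) = finrank K Ext := by
    apply le_antisymm (Submodule.finrank_le (range ob))
    calc finrank K Ext ≤ finrank K (range (σ ∘ₗ ob)) := h
      _ ≤ finrank K (range ob) := finrank_range_comp_le_first ob σ
  have hob_top : range ob = ⊤ := Submodule.eq_top_of_finrank_eq hob_rank
  have hsurj : Function.Surjective ob := LinearMap.range_eq_top.mp hob_top
  -- σ injective
  have hσ_rank : finrank K (range σ) = finrank K Ext := by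
    apply le_antisymm (LinearMap.finrank_range_le σ)
    calc finrank K Ext ≤ finrank K (range (σ ∘ₗ ob)) := h
      _ ≤ finrank K (range σ) := Submodule.finrank_mono (LinearMap.range_comp_le_range ob σ)
  have hker : finrank K (ker σ) = 0 := by
    have := LinearMap.finrank_range_add_finrank_ker σ
    omega
  have hinj : Function.Injective σ := by
    rw [← LinearMap.ker_eq_bot]
    exact Submodule.finrank_eq_zero.mp hker
  exact ⟨hsurj, hinj, heq⟩

/-- THEOREM S as used in FORMULA-N §3.4 / FN-1: with the bridge `σ ∘ ob = c` (c = contraction against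
ch(G) on HT^k), a rank `R` of `c` and the Ext-bound `dim Ext ≤ R`: ob onto, σ injective, dim Ext = R,
dim ker ob = dim HT − R, and rank σ = R. -/
theorem theoremS (ob : HT →ₗ[K] Ext) (σ : Ext →ₗ[K] H) (c : HT →ₗ[K] H)
    (bridge : σ ∘ₗ ob = c) (R : ℕ) (hR : finrank K (range c) = R)
    (hExt : finrank K Ext ≤ R) :
    Function.Surjective ob ∧ Function.Injective σ ∧ finrank K Ext = R ∧
      finrank K (ker ob) = finrank K HT - R ∧ finrank K (range σ) = R := by
  have h : finrank K Ext ≤ finrank K (range (σ ∘ₗ ob)) := by rw [bridge, hR]; exact hExt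
  obtain ⟨hsurj, hinj, heq⟩ := squeeze ob σ h
  have hExtR : finrank K Ext = R := by rw [heq, bridge, hR]
  have hker : finrank K (ker ob) = finrank K HT - R := by
    have h1 := LinearMap.finrank_range_add_finrank_ker ob
    have h2 : finrank K (range ob) = finrank K Ext := by
      rw [LinearMap.range_eq_top.mpr hsurj]; exact finrank_top K Ext
    omega
  have hσ : finrank K (range σ) = R := by
    have h1 := LinearMap.finrank_range_add_finrank_ker σ
    have h2 : finrank K (ker σ) = 0 := by
      rw [LinearMap.ker_eq_bot.mpr hinj]; exact finrank_bot K Ext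
    omega
  exact ⟨hsurj, hinj, hExtR, hker, hσ⟩

end Summit.Ventures.HSemireg.FormulaN.Squeeze
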